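import Summits.CriticalPhenomena.CardyFormulaZ2.Theses.CardyWhiteToColoured
import Summits.CriticalPhenomena.CardyFormulaZ2.Theses.CardyUniqueLimit
import Summits.CriticalPhenomena.CardyFormulaZ2.Theses.CardyTensorRG
import Literature.Probability.Percolation.InterfaceScalingLimitDiscretised
import Literature.Probability.RandomPlanarGeometry.CritPercSLEProofs

/-!
# Birth skeleton (BC3) for the crux `CardyRigidity` — stmt-CriticalPhenomena-0746

Crux (shared decl; filed verbatim on routes CardyUniqueLimit r2 (original owner),
CardyWhiteToColoured r5 (this unit's route), CardyTensorRG r6, CardyQContinuation r4,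
CardyCapacityWard r5, PivotalEnergyLaw r6, CardyOrderDuality r6, CardyStressTensorWard (support);
all copies are the same `Prop`, see the `Iff.rfl` certificates at the end of the file):

  `CardyRigidity : ∀ f : ℝ → ℝ, (∀ R : ConformalRectangle, R.HasCrossingLimit (bondDomainCrossingProb R) f)
      → Set.EqOn f cardyFunction (Set.Ioo 0 1)`

— if the bond-`ℤ²` crossing probabilities of ALL conformal rectangles converge to a function `f` of
the cross-ratio, then `f` is Cardy's function on `(0,1)`.

## The line (Schramm 2000 §1.5 / LSW 2001 / Smirnov 2001 Thm 2, run with an UNKNOWN kernel `f`)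

Write `HYP f` for the hypothesis of the crux and

  `LIM κ := ∀ (D : DobrushinDomain) (E : ℝ → DiscreteDobrushin), ZdDiscretisationFamily D E →
      ConvergesInLawToSLE κ D (fun δ ↦ bondInterfaceIn D (E δ)) (fun _ ↦ P_{1/2})`

("the bond-`ℤ²` medial exploration interface converges in law to chordal SLE_κ in every
discretised Dobrushin domain" — the body of the tree's `SLE6LimitZ2AllDiscretisations`
(`InterfaceScalingLimitDiscretised.lean`) with `6` replaced by a free `κ`).

* `stub_kernelForcesSLE` (Camia–Newman / Smirnov-Thm-2 machine with unknown kernel; HARDEST):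
  `HYP f → ∃ κ > 4, LIM κ`. A conformally invariant crossing kernel makes every subsequential
  limit of the exploration path (Aizenman–Burchard tightness `isTightLaws_map_bondInterface` + RSW
  `rsw_half`) a conformally invariant domain-Markov chordal curve, hence chordal SLE_κ (Schramm's
  principle), and uniqueness of the kernel upgrades subsequential to full convergence; the
  pointwise→locally-uniform bridge on moving slit domains (RSW equicontinuity + Jordan sandwiching
  + Carathéodory continuity of the modulus) is the unprinted content — refuter rreview1
  (2026-08-16) objection (a). `κ > 4` because RSW keeps `f` inside `(0,1)`
  (`discreteCrossingProb_clusterPt_mem_Ioo_holds`) while SLE_κ, `κ ≤ 4`, never touches the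
  boundary (`measureReal_hitsBefore_eq_zero_of_le_four`).
* `stub_localityPinsKappa` (locality of percolation passes to the limit; LSW 2001 Cor. 2.3 /
  Werner 2007 Prop. 3.4): `4 < κ → LIM κ → κ = 6`. The discrete exploration process from `a` in
  `(D; a, b, b')` does not see which of `b`, `b'` is its target before it hits the arc `[b, b']`
  (exactly, at every mesh); passing this to the limit (stopAt-continuity a.s., from RSW boundary
  estimates) makes the family of SLE_κ laws `ChordalFamily.IsTargetIndependent`, and the PROVED
  tree theorem `eq_six_of_isSLELaw_of_isTargetIndependent_of_four_lt`
  (`SLETargetIndependenceSix.lean`) pins `κ = 6`. This is the κ-pinning input the refuter's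
  GROUNDING GAP (b) asks for: it does NOT use Cardy's explicit `F` (the cited fact
  `eq_six_of_forall_measureReal_hitsBefore` would be circular here).
* `stub_kernelReadout` (the crossing event is a continuity set of the limit; Lawler 2005
  Prop. 6.33): `HYP f → 4 < κ → LIM κ → Set.EqOn f (swallowingProb (2/κ)) (Set.Ioo 0 1)`. The
  discrete event "the interface from `a` to `c` hits `(cd)` before `(bc)`" IS an open crossing
  `(ab) ↔ (cd)`; its probability tends to `f(η)` by `HYP` and to the SLE_κ value `Ψ_{2/κ}(η)`
  (`measureReal_hitsBefore_eq_swallowingProb`); the moduli `η` of conformal rectangles exhaust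
  `(0,1)` (Carleson triangles, cf. `exists_isSLELaw_cardyFunction_crossRatio_eq`).

Device (D-0027 §3.3, as in `Cruxes/CriticalPathRSW/Lines/finite_size_envelope.lean`): each stub is a sorried
theorem `Holds.stub_<name> : <full statement over tree declarations>` (registered under the short name
`stub_<name>` with that text) plus the by-name handle `def stub_<name> : Prop := type_of% Holds.stub_<name>`,
and the hypotheses of `CardyRigidity_of` are exactly these three handles, by name.

Composition `CardyRigidity_of` (real proof, no sorry): `κ = 6` gives `2/κ = 1/3`, and
`swallowingProb_one_third : swallowingProb (1/3) = cardyFunction` (Lawler Cor. 6.35, proved in the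
tree) turns stub C's conclusion into the crux, BY NAME.

Negatives / dead lines honoured: the refuted abstract Schramm principle stmt-CriticalPhenomena-0698
(`not_SymmetryUpgrade`: fat-germ surgery of the SLE₆ family) is NOT assumed — every stub speaks
about the laws of the concrete bond-`ℤ²` interface, which are genuine scaling limits (the repaired
clause of `R2SymmetryUpgradeR`). No `Disproof.lean` exists for this crux yet
(`ledger crux ls stmt-CriticalPhenomena-0746`: no workfiles, 2026-08-17).
-/

noncomputable section

namespace Summit.CriticalPhenomena.CardyFormulaZ2.Cruxes.CardyRigidity.Birth

open scoped NNReal Topology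
open Set Filter MeasureTheory
open Summit.CriticalPhenomena.CardyFormulaZ2.Theses.CardyWhiteToColoured (CardyRigidity)

/-! ### The three registered stubs (the ONLY `sorry`s of this file) and their by-name handles -/

/-- **Stub A — a conformally invariant crossing kernel forces an SLE_κ scaling limit (`κ > 4`).**
If the bond-`ℤ²` crossing probabilities of every conformal rectangle converge to `f(cross-ratio)`,
then for some `κ > 4` the medial exploration interface of critical bond percolation converges in law
to chordal SLE_κ in every discretised Dobrushin domain (Smirnov 2001 Thm 2 / Camia–Newman 2007
§§5–7 / Werner 2007 §3, run with the unknown kernel `f`; AB tightness + RSW + Schramm 2000).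
Size XL (hardest stub; carries the pointwise→locally-uniform bridge). -/
protected theorem Holds.stub_kernelForcesSLE : ∀ f : ℝ → ℝ, (∀ R : Literature.Probability.RandomPlanarGeometry.ConformalRectangle, R.HasCrossingLimit (Literature.Probability.Percolation.bondDomainCrossingProb R) f) → ∃ κ : ℝ≥0, 4 < κ ∧ ∀ (D : Literature.Probability.RandomPlanarGeometry.DobrushinDomain) (E : ℝ → Literature.Probability.LatticeModels.DiscreteDobrushin), Literature.Probability.LatticeModels.ZdDiscretisationFamily D E → Literature.Probability.RandomPlanarGeometry.ConvergesInLawToSLE κ D (Ωδ := fun _ => Literature.Probability.Percolation.BondConfig (Literature.Probability.LatticeModels.Site 2)) (fun δ => Literature.Probability.Percolation.bondInterfaceIn D (E δ)) (fun _ => Literature.Probability.Percolation.bondPercolation (Literature.Probability.LatticeModels.zdGraph 2) Literature.Probability.Percolation.half) := by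
  sorry

/-- By-name handle of the registered stub `Holds.stub_kernelForcesSLE`. -/
def stub_kernelForcesSLE : Prop := type_of% Holds.stub_kernelForcesSLE

/-- **Stub B — locality of percolation pins `κ = 6`.** If, for some `κ > 4`, the bond-`ℤ²`
exploration interface converges in law to chordal SLE_κ in every discretised Dobrushin domain, then
`κ = 6`: the exploration process is target independent before it hits the far arc (exactly, at every
mesh), this passes to the limit family of SLE_κ laws (`ChordalFamily.IsTargetIndependent`), and
`eq_six_of_isSLELaw_of_isTargetIndependent_of_four_lt` (LSW 2001 Cor. 2.3; Werner 2007 Prop. 3.4;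
proved in the tree) gives `κ = 6`. No use of Cardy's explicit `F`. Size L. -/
protected theorem Holds.stub_localityPinsKappa : ∀ κ : ℝ≥0, 4 < κ → (∀ (D : Literature.Probability.RandomPlanarGeometry.DobrushinDomain) (E : ℝ → Literature.Probability.LatticeModels.DiscreteDobrushin), Literature.Probability.LatticeModels.ZdDiscretisationFamily D E → Literature.Probability.RandomPlanarGeometry.ConvergesInLawToSLE κ D (Ωδ := fun _ => Literature.Probability.Percolation.BondConfig (Literature.Probability.LatticeModels.Site 2)) (fun δ => Literature.Probability.Percolation.bondInterfaceIn D (E δ)) (fun _ => Literature.Probability.Percolation.bondPercolation (Literature.Probability.LatticeModels.zdGraph 2) Literature.Probability.Percolation.half)) → κ = 6 := by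
  sorry

/-- By-name handle of the registered stub `Holds.stub_localityPinsKappa`. -/
def stub_localityPinsKappa : Prop := type_of% Holds.stub_localityPinsKappa

/-- **Stub C — kernel readout: the limit kernel is the SLE_κ crossing law `Ψ_{2/κ}`.** If the
crossing probabilities converge to `f(cross-ratio)` and the interface converges to chordal SLE_κ
(`κ > 4`) in every discretised Dobrushin domain, then `f = swallowingProb (2/κ)` on `(0,1)`: the
discrete event "the interface from `a` to `c` hits `(cd)` before `(bc)`" is an open crossing
`(ab) ↔ (cd)`, it is a continuity set of the SLE_κ law (RSW boundary estimates), its SLE_κ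
probability is `Ψ_{2/κ}(η)` (Lawler 2005 Prop. 6.33, `measureReal_hitsBefore_eq_swallowingProb`),
and the moduli of conformal rectangles exhaust `(0,1)`. Size L. -/
protected theorem Holds.stub_kernelReadout : ∀ (f : ℝ → ℝ) (κ : ℝ≥0), (∀ R : Literature.Probability.RandomPlanarGeometry.ConformalRectangle, R.HasCrossingLimit (Literature.Probability.Percolation.bondDomainCrossingProb R) f) → 4 < κ → (∀ (D : Literature.Probability.RandomPlanarGeometry.DobrushinDomain) (E : ℝ → Literature.Probability.LatticeModels.DiscreteDobrushin), Literature.Probability.LatticeModels.ZdDiscretisationFamily D E → Literature.Probability.RandomPlanarGeometry.ConvergesInLawToSLE κ D (Ωδ := fun _ => Literature.Probability.Percolation.BondConfig (Literature.Probability.LatticeModels.Site 2)) (fun δ => Literature.Probability.Percolation.bondInterfaceIn D (E δ)) (fun _ => Literature.Probability.Percolation.bondPercolation (Literature.Probability.LatticeModels.zdGraph 2) Literature.Probability.Percolation.half)) → Set.EqOn f (Literature.Probability.RandomPlanarGeometry.swallowingProb (2 / (κ : ℝ))) (Set.Ioo 0 1) := by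
  sorry

/-- By-name handle of the registered stub `Holds.stub_kernelReadout`. -/
def stub_kernelReadout : Prop := type_of% Holds.stub_kernelReadout

/-! ### Composition (sorry-free): the three stubs imply the crux BY NAME -/

/-- **The composition (real proof).** Stub A gives `κ > 4` and SLE_κ convergence of the interface;
stub B pins `κ = 6`; stub C reads `f = Ψ_{2/κ} = Ψ_{1/3}` on `(0,1)`, and
`swallowingProb_one_third : Ψ_{1/3} = cardyFunction` (Lawler Cor. 6.35, proved in the tree)
concludes the crux BY NAME (`CardyWhiteToColoured.CardyRigidity`, the route of this unit). -/
theorem CardyRigidity_of :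
    stub_kernelForcesSLE → stub_localityPinsKappa → stub_kernelReadout → CardyRigidity := by
  intro hA hB hC
  dsimp only [stub_kernelForcesSLE, stub_localityPinsKappa, stub_kernelReadout] at hA hB hC
  intro f hf
  obtain ⟨κ, hκ, hlim⟩ := hA f hf
  have h6 : κ = 6 := hB κ hκ hlim
  have hread := hC f κ hf hκ hlim
  have h13 : (2 : ℝ) / ((κ : ℝ≥0) : ℝ) = 1 / 3 := by
    rw [h6]; push_cast; norm_num
  rw [h13, Literature.Probability.RandomPlanarGeometry.swallowingProb_one_third] at hread
  exact hread

/-- **The crux BY NAME from the three stubs** (route CardyWhiteToColoured; depends on `sorryAx`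
ONLY through `Holds.stub_kernelForcesSLE`, `Holds.stub_localityPinsKappa`, `Holds.stub_kernelReadout`
— this line also certifies mechanically that the handles ARE the stub statements). -/
theorem CardyRigidity_proof : CardyRigidity :=
  CardyRigidity_of Holds.stub_kernelForcesSLE Holds.stub_localityPinsKappa Holds.stub_kernelReadout

/-- The same composition concludes the shared decl as filed on route CardyUniqueLimit (r2, the
original owner of stmt-CriticalPhenomena-0746): the `def`s are syntactically identical, so the
term `CardyRigidity_of` re-typechecks against it by `δ`-unfolding. -/
theorem CardyRigidity_of_uniqueLimit :
    stub_kernelForcesSLE → stub_localityPinsKappa → stub_kernelReadout →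
      Summit.CriticalPhenomena.CardyFormulaZ2.Theses.CardyUniqueLimit.CardyRigidity :=
  CardyRigidity_of

/-- … and as filed on route CardyTensorRG (r6). -/
theorem CardyRigidity_of_tensorRG :
    stub_kernelForcesSLE → stub_localityPinsKappa → stub_kernelReadout →
      Summit.CriticalPhenomena.CardyFormulaZ2.Theses.CardyTensorRG.CardyRigidity :=
  CardyRigidity_of

-- Certificates that the shared decl is ONE `Prop` across the route files (definitional):
example : CardyRigidity ↔ Summit.CriticalPhenomena.CardyFormulaZ2.Theses.CardyUniqueLimit.CardyRigidity :=
  Iff.rfl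
example : CardyRigidity ↔ Summit.CriticalPhenomena.CardyFormulaZ2.Theses.CardyTensorRG.CardyRigidity :=
  Iff.rfl

end Summit.CriticalPhenomena.CardyFormulaZ2.Cruxes.CardyRigidity.Birth

end
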